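import Literature.NumberTheory.DiophantineGeometry.KroneckerSemigroup
import Literature.NumberTheory.DiophantineGeometry.SymmetricGroupRepsSignTwist
import Literature.Computability.Complexity.OccurrenceObstructionsIPSemigroup
import Literature.Combinatorics.Enumerative.DiscreteTomography
import HarnessLib

/-!
# Point sets with prescribed marginals and positivity of Kronecker coefficients
# (Ikenmeyer–Mulmuley–Walter 2017, §2–§3: the bounds `p ≤ k ≤ t` in positivity form,
# Lemma 3.1 and Theorem 3.2)

Source: C. Ikenmeyer, K. D. Mulmuley, M. Walter, *On vanishing of Kronecker coefficients*,
Comput. Complexity 26 (2017) 949–992 = arXiv:1507.02955 (held), §2 (Lemmas 2.1–2.3, Cor. 2.4)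
and §3 (Lemma 3.1, Thm. 3.2) [key `IkenmeyerMulmuleyWalter2017`]. This is the
representation-theoretic half of IMW's Theorem 1.1 ("KRONECKER is NP-hard",
`Literature.Barriers.ValiantsHypothesis.IMW2017_kroneckerNPHard`); the complexity-theoretic half
(Thm. 3.3, after Brunetti–Del Lungo–Gérard) lives with the barrier.

For a finite point set `P ⊆ ℕ³` the marginals `x_P, y_P, z_P : ℕ → ℕ` count the points in the
planes `x = i`, `y = j`, `z = l`; these, the simplex `P_r`, pyramids and the exchange lemma are the
tree's `Literature.Combinatorics.Enumerative.Tomography.*` (`DiscreteTomography.lean`), reused here. For partitions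
`λ, μ, π ⊢ n`, IMW put `t^λ_{μ,π}` = the number of point sets with marginals `(λᵀ, μᵀ, πᵀ)`
(`HasMarginals`, `pointSetCount`; `λᵀ_i` = the length of column `i` of `λ`) and `p^λ_{μ,π}` = the
number of those that are *pyramids* (down-sets, `IsPyramid`, `pyramidCount`), and prove
`p ≤ k ≤ t` for the Kronecker coefficient `k^λ_{μ,π} = g(λ, μ, π)` (Lemma 2.3; Manivel,
Bürgisser–Ikenmeyer, Vallejo), with equality when every compatible point set is a pyramid
(Cor. 2.4), which is the case for *simplex-like* triples (Lemma 3.1, Thm. 3.2).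

## What is proved here (everything; no named facts), for any field `k` of characteristic zero

* `exists_hasMarginals_of_kroneckerCoeff_pos`, `pointSetCount_pos_of_kroneckerCoeff_pos`:
  **`k > 0 ⇒ t > 0`** (positivity content of the upper bound of Lemma 2.3).
* `kroneckerCoeff_pos_of_isPyramid`, `kroneckerCoeff_pos_of_pyramidCount_pos`:
  **`p > 0 ⇒ k > 0`** (positivity content of the lower bound of Lemma 2.3).
* `kroneckerCoeff_pos_iff_pointSetCount_pos_of_forall_isPyramid`: Cor. 2.4 in positivity form.
* `IsSimplexLike.simplex_subset`, `IsSimplexLike.isPyramid`: **Lemma 3.1** from the tree's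
  exchange lemma of Brunetti–Del Lungo–Gérard (`Tomography.exchange_eq_iff`: an `n`-point set has
  `∑ (x+y+z) ≥ p(n)` with equality iff `P_r ⊆ P ⊆ P_{r+1}`, and then `P` is a pyramid).
* `IsSimplexLike.kroneckerCoeff_pos_iff` (**Thm. 3.2 in positivity form**: for simplex-like
  triples `k^λ_{μ,π} > 0 ↔ t^λ_{μ,π} > 0`) and `IsSimplexLike.pointSetCount_eq_pyramidCount`
  (`t = p`).

Not proved here: the multiplicity statements `p ≤ k ≤ t` themselves and `k = t` (IMW Thm. 3.2,
first equality), which need the linear independence of the `ψ_P` and are not used by the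
NP-hardness reduction (Thm. 3.4 transports positivity only).

## Proofs (ours differ from the printed ones in the model, not in substance)

IMW work in `∧ⁿ(ℂ^r)^{⊗3}` (Lemma 2.1: `k^λ_{μ,π}` is the multiplicity of
`V_{λᵀ} ⊗ V_{μᵀ} ⊗ V_{πᵀ}`; Lemma 2.2: `t` is a weight multiplicity; pyramids give highest weight
vectors). We stay in the tree's word model of `((k^N)^{⊗n})^{⊗3}` (`KroneckerSemigroup`:
`tripleHw`, `tripleHwRep`, `g(λ, μ, ν) = dim (HW_λ ⊗ HW_μ ⊗ HW_ν)^{S_n}`):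

* **Upper bound.** The *anti*-invariants of `S_n` in `HW_λ ⊗ HW_μ ⊗ HW_ν` (the invariants of the
  sign twist `signTwist`, `SymmetricGroupRepsSignTwist`) have dimension
  `(1/n!) ∑_σ sgn(σ) χ^λ χ^μ χ^ν = (1/n!) ∑_σ χ^λ χ^μ χ^{νᵀ} = g(λ, μ, νᵀ)`
  (`finrank_invariants_signTwist_tripleHwRep`; `χ^{νᵀ} = sgn χ^ν`, `spechtCharacter_transpose`;
  `kroneckerCoeff_eq_sum_spechtCharacter_holds`). A nonzero anti-invariant triple tensor `M` has
  some `M(w₁, w₂, w₃) ≠ 0`; weight vectors are supported on words of the right content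
  (`apply_eq_zero_of_mem_highestWeightSpace`), and anti-invariance under the transposition of
  two positions with equal letters forces `p ↦ (w₁ p, w₂ p, w₃ p)` to be injective, so its
  image is an `n`-point SET with marginals `(λ, μ, ν)` (`marginals_pointSetOfWord3`). With
  `g(λ, μ, π) = g(λᵀ, μᵀ, π)` (`kroneckerCoeff_transpose₁₂`) this is `k > 0 ⇒ t > 0`.
* **Lower bound.** Instead of checking that `ψ_P` is a highest weight vector we peel a pyramid
  `P` into its bottom slice `P₀ = {(y,z) : (0,y,z) ∈ P}` (a Young diagram `D`) and the shifted
  rest `P'` (`slice0`, `shiftDown`); in the row bookkeeping `(λ, μᵀ, πᵀ)` the marginal partitions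
  of `P` are the ROW-WISE sum of `((1^{|D|}), rows D, cols D)` and those of `P'`
  (`IsPyramid.getD_xPart_eq` etc.), `g((1^m), ρ, ρᵀ) = g((m), ρᵀ, ρᵀ) = 1 > 0`
  (`kroneckerCoeff_indiscrete_transpose_pos`, from `kroneckerCoeff_indiscrete_pos` and the
  transposition property), and the semigroup property of Christandl–Harrow–Mitchison
  (`kroneckerCoeff_pos_of_ofPartition_add`, `KroneckerSemigroup`) gives `g(λ, μᵀ, πᵀ) > 0`, i.e.
  `g(λ, μ, π) > 0` (`kroneckerCoeff_transpose`).
* **Lemma 3.1.** The coordinate sum of `P` is `columnMoment λ μ π` (a function of the marginals),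
  which for simplex-like triples is `p(n)`, the equality case of the tree's exchange inequality
  `Tomography.exchange_le`/`exchange_eq_iff`; hence `P_r ⊆ P ⊆ P_{r+1}` and `P` is a pyramid
  (`Tomography.isPyramid_of_simplex_subset`).

## Conventions

`simplexRadius n = r(n)` is the largest `r` with `|P_r| ≤ n`, `minMoment n = p(n)`;
`IsSimplexLike` is IMW's moment identity `∑ i λᵀ_i + ∑ j μᵀ_j + ∑ k πᵀ_k = p(n)` with `n ≠ 0`
(IMW also ask for at most `r + 1` columns, a condition implied for consistent instances and not
used in the proof of Lemma 3.1; omitting it only enlarges the class). Column lengths are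
Mathlib's `YoungDiagram.colLen` of the tree's `Nat.Partition.youngDiagram`
(`getD_sortedParts_transpose`: the rows of `λᵀ`).

## References

* C. Ikenmeyer, K. D. Mulmuley, M. Walter, Comput. Complexity 26 (2017) 949–992,
  arXiv:1507.02955, §2–§3. [IkenmeyerMulmuleyWalter2017]
* S. Brunetti, A. Del Lungo, Y. Gérard, Linear Algebra Appl. 339 (2001) 59–73, §3 (the discrete
  simplex and its barycentre). [BrunettiDelLungoGerard2001]
* C. Ikenmeyer, G. Panova, Adv. Math. 319 (2017), §1.1 (semigroup and transposition
  properties). [IkenmeyerPanova2017]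

## Mathlib and tree

Mathlib: `YoungDiagram` (`rowLen`, `colLen`, `rowLens`, `ofRowLens_to_rowLens_eq_self`,
`mem_iff_lt_rowLen`, `mem_iff_lt_colLen`), `Representation.card_inv_mul_sum_char_eq_finrank`,
`Equiv.Perm.sign_swap`, `Nat.findGreatest`, `Finset.card_eq_sum_card_fiberwise`,
`Finset.sum_fiberwise_of_maps_to`. Tree: `Tomography.xMarginal`/`simplex`/`IsPyramid`/`coordSum`,
`coordSum_eq_sum_marginals`, `exchange_eq_iff`, `isPyramid_of_simplex_subset`, `card_eq_sum_xMarginal`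
(`DiscreteTomography`); `tripleHw`, `tripleHwRep`, `Word3`, `permute3`, `zip3`,
`mem_tripleHw_iff`, `coe_tripleHwRep_apply`, `kroneckerCoeff_pos_of_ofPartition_add`
(`KroneckerSemigroup`); `signTwist`, `character_signTwist`, `spechtCharacter_transpose`,
`kroneckerCoeff_transpose`, `kroneckerCoeff_transpose₁₂`, `Nat.Partition.transpose_transpose`,
`parts_eq_of_youngDiagram_eq` (`SymmetricGroupRepsSignTwist`); `character_hwPermRep`
(`WordHighestWeightSpecht`); `apply_eq_zero_of_mem_highestWeightSpace`, `wordContent`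
(`TensorWordModel`); `kroneckerCoeff_indiscrete_pos`, `sortedParts_indiscrete` (`KroneckerOneRow`);
`partitionOfRows`, `getD_sortedParts_partitionOfRows`, `getD_sortedParts_eq_zero`,
`sum_range_getD_sortedParts_of_le`, `Nat.Partition.card_parts_le_size` (Ikenmeyer–Panova files
under `Literature/Computability/Complexity/OccurrenceObstructions*`); `rowLen_youngDiagram`.
-/

noncomputable section

open scoped BigOperators TensorProduct

namespace Literature.NumberTheory.DiophantineGeometry

open Literature.Combinatorics.Enumerative.Tomography

/-! ### Anti-invariant triple tensors: `dim = g(λ, μ, νᵀ)` -/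

section AntiInvariants

variable (k : Type*) [Field k] {N n : ℕ}

/-- **The character of `S_n` on `HW_λ ⊗ HW_μ ⊗ HW_ν` is `χ^λ χ^μ χ^ν`** (partitions with at most `N`
parts, characteristic zero): characters of tensor products multiply (Fulton–Harris Prop. 2.1)
and Schur–Weyl duality `χ_{HW_μ} = χ^μ` (`character_hwPermRep`, Fulton–Harris Thm. 6.3 (2)).
[cite: FultonHarrisGTM129, Prop. 2.1 and Thm. 6.3 (2)] -/
theorem character_tripleHwRep [CharZero k] (lam mu nu : Nat.Partition n)
    (hl : lam.parts.card ≤ N) (hm : mu.parts.card ≤ N) (hn : nu.parts.card ≤ N)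
    (g : Equiv.Perm (Fin n)) :
    (tripleHwRep k N n (Weight.ofPartition N lam) (Weight.ofPartition N mu)
        (Weight.ofPartition N nu)).character g =
      spechtCharacter k lam g * spechtCharacter k mu g * spechtCharacter k nu g := by
  have hYle := highestWeightSpace_le_comap_wordPermRep k (D := n) (Weight.ofPartition N lam)
  have hXle := highestWeightSpace_le_comap_wordPermRep k (D := n) (Weight.ofPartition N mu)
  have hZle := highestWeightSpace_le_comap_wordPermRep k (D := n) (Weight.ofPartition N nu)
  have h3 := Representation.char_iso
    (V := ↥(sliceSubmodule (highestWeightSpace (wordRep k N n) (Weight.ofPartition N lam))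
          (highestWeightSpace (wordRep k N n) (Weight.ofPartition N mu))) ⊗[k]
      ↥(highestWeightSpace (wordRep k N n) (Weight.ofPartition N nu)))
    (sliceRepEquiv (sliceSubmodule_le_comap_pairRep hYle hXle) hZle)
  rw [Representation.char_tensor] at h3
  have h3g := congrFun h3 g
  rw [Pi.mul_apply] at h3g
  change _ = (tripleHwRep k N n (Weight.ofPartition N lam) (Weight.ofPartition N mu)
        (Weight.ofPartition N nu)).character g at h3g
  rw [← h3g]
  have h12 := Representation.char_iso
    (V := ↥(highestWeightSpace (wordRep k N n) (Weight.ofPartition N lam)) ⊗[k]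
      ↥(highestWeightSpace (wordRep k N n) (Weight.ofPartition N mu)))
    (sliceRepEquiv hYle hXle)
  rw [Representation.char_tensor] at h12
  have h12g := congrFun h12 g
  rw [Pi.mul_apply] at h12g
  have hY : ((wordPermRep k N n).subrepresentation
      (highestWeightSpace (wordRep k N n) (Weight.ofPartition N lam)) hYle).character =
      spechtCharacter k lam := character_hwPermRep k lam hl
  have hX : ((wordPermRep k N n).subrepresentation
      (highestWeightSpace (wordRep k N n) (Weight.ofPartition N mu)) hXle).character =
      spechtCharacter k mu := character_hwPermRep k mu hm
  have hZ : ((wordPermRep k N n).subrepresentation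
      (highestWeightSpace (wordRep k N n) (Weight.ofPartition N nu)) hZle).character =
      spechtCharacter k nu := character_hwPermRep k nu hn
  rw [hY, hX] at h12g
  have h1 : ((pairRep (wordPermRep k N n) (wordPermRep k N n)).subrepresentation
        (sliceSubmodule (highestWeightSpace (wordRep k N n) (Weight.ofPartition N lam))
          (highestWeightSpace (wordRep k N n) (Weight.ofPartition N mu)))
        (sliceSubmodule_le_comap_pairRep hYle hXle)).character g =
      spechtCharacter k lam g * spechtCharacter k mu g := h12g.symm
  rw [h1, hZ]

/-- **`n! · dim (HW_λ ⊗ HW_μ ⊗ HW_ν)^{S_n, sgn} = ∑_σ χ^λ(σ) χ^μ(σ) χ^{νᵀ}(σ)`**: the invariants of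
the sign twist are the anti-invariants, `dim V^G = |G|⁻¹ ∑ χ_V` (Fulton–Harris (2.9)),
`χ_{V ⊗ sgn} = sgn χ_V`, and `sgn χ^ν = χ^{νᵀ}` (`spechtCharacter_transpose`).
[cite: FultonHarrisGTM129, §2.2 (2.9) and Exercise 4.4 (c)] -/
theorem card_mul_finrank_invariants_signTwist_tripleHwRep [CharZero k] (lam mu nu : Nat.Partition n)
    (hl : lam.parts.card ≤ N) (hm : mu.parts.card ≤ N) (hn : nu.parts.card ≤ N) :
    (Nat.factorial n : k) *
        (Module.finrank k (signTwist k (tripleHwRep k N n (Weight.ofPartition N lam)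
          (Weight.ofPartition N mu) (Weight.ofPartition N nu))).invariants : k) =
      ∑ g : Equiv.Perm (Fin n),
        spechtCharacter k lam g * spechtCharacter k mu g * spechtCharacter k nu.transpose g := by
  have hcard : Nat.card (Equiv.Perm (Fin n)) = n.factorial := by
    rw [Nat.card_eq_fintype_card, Fintype.card_perm, Fintype.card_fin]
  haveI : Invertible (Nat.card (Equiv.Perm (Fin n)) : k) :=
    invertibleOfNonzero (by rw [hcard]; exact_mod_cast n.factorial_ne_zero)
  have h := Representation.card_inv_mul_sum_char_eq_finrank
    (signTwist k (tripleHwRep k N n (Weight.ofPartition N lam)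
      (Weight.ofPartition N mu) (Weight.ofPartition N nu)))
  rw [hcard] at h
  rw [← h, ← mul_assoc, mul_inv_cancel₀ (by exact_mod_cast n.factorial_ne_zero), one_mul]
  refine Finset.sum_congr rfl fun g _ => ?_
  rw [character_signTwist, character_tripleHwRep k lam mu nu hl hm hn, spechtCharacter_transpose]
  ring

/-- **`dim (HW_λ ⊗ HW_μ ⊗ HW_ν)^{S_n, sgn} = g(λ, μ, νᵀ)`**: the anti-invariant triple tensors have
dimension a Kronecker coefficient with one partition transposed (the `S_n`-side form of IMW
Lemma 2.1, `k^λ_{μ,π}` = multiplicity in the antisymmetric cube), by the character formula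
`n! g(λ, μ, ν) = ∑ χ^λ χ^μ χ^ν` (`kroneckerCoeff_eq_sum_spechtCharacter_holds`).
[cite: IkenmeyerMulmuleyWalter2017, Lemma 2.1] -/
theorem finrank_invariants_signTwist_tripleHwRep [CharZero k] (lam mu nu : Nat.Partition n)
    (hl : lam.parts.card ≤ N) (hm : mu.parts.card ≤ N) (hn : nu.parts.card ≤ N) :
    Module.finrank k (signTwist k (tripleHwRep k N n (Weight.ofPartition N lam)
        (Weight.ofPartition N mu) (Weight.ofPartition N nu))).invariants =
      kroneckerCoeff k lam mu nu.transpose := by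
  have h1 := card_mul_finrank_invariants_signTwist_tripleHwRep k lam mu nu hl hm hn
  have h2 := kroneckerCoeff_eq_sum_spechtCharacter_holds k lam mu nu.transpose
  rw [← h2, Nat.cast_mul] at h1
  have h3 := mul_left_cancel₀ (Nat.cast_ne_zero.mpr (Nat.factorial_ne_zero n)) h1
  exact_mod_cast h3

/-- A positive `g(λ, μ, νᵀ)` gives a nonzero ANTI-invariant triple tensor `M ∈ HW_λ ⊗ HW_μ ⊗ HW_ν`:
`M(τ · t) = sgn(τ) M(t)` for the diagonal position action. [cite: IkenmeyerMulmuleyWalter2017, Lemma 2.1] -/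
theorem exists_antiInvariant_of_kroneckerCoeff_pos [CharZero k] {lam mu nu : Nat.Partition n}
    (hl : lam.parts.card ≤ N) (hm : mu.parts.card ≤ N) (hn : nu.parts.card ≤ N)
    (h : 0 < kroneckerCoeff k lam mu nu.transpose) :
    ∃ M : Word3 N n → k, M ∈ tripleHw k N n (Weight.ofPartition N lam) (Weight.ofPartition N mu)
        (Weight.ofPartition N nu) ∧ M ≠ 0 ∧
      ∀ τ t, M (permute3 τ t) = ((Equiv.Perm.sign τ : ℤ) : k) * M t := by
  rw [← finrank_invariants_signTwist_tripleHwRep k lam mu nu hl hm hn] at h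
  obtain ⟨x, hx⟩ := (Module.finrank_pos_iff_exists_ne_zero (R := k)
    (M := ↥(signTwist k (tripleHwRep k N n (Weight.ofPartition N lam) (Weight.ofPartition N mu)
      (Weight.ofPartition N nu))).invariants)).mp h
  set Mx : Word3 N n → k := ((x : tripleHw k N n (Weight.ofPartition N lam)
    (Weight.ofPartition N mu) (Weight.ofPartition N nu)) : Word3 N n → k) with hMx
  refine ⟨Mx, x.1.2, ?_, ?_⟩
  · intro h0
    apply hx
    apply Subtype.ext
    apply Subtype.ext
    exact h0
  · intro τ t
    have hinv := (Representation.mem_invariants _ _).1 x.2 τ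
    rw [signTwist_apply, LinearMap.smul_apply] at hinv
    have := congrArg (fun y : tripleHw k N n (Weight.ofPartition N lam) (Weight.ofPartition N mu)
      (Weight.ofPartition N nu) => (y : Word3 N n → k) t) hinv
    simp only [Submodule.coe_smul_of_tower, Pi.smul_apply, coe_tripleHwRep_apply, smul_eq_mul] at this
    -- this : sign τ * Mx (permute3 τ t) = Mx t
    have hs := sign_cast_mul_self (k := k) τ
    have e : Mx (permute3 τ t) = ((Equiv.Perm.sign τ : ℤ) : k) *
        (((Equiv.Perm.sign τ : ℤ) : k) * Mx (permute3 τ t)) := by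
      rw [← mul_assoc, hs, one_mul]
    rw [e, this]

/-- **Support of triple tensors, contents**: if `M ∈ HW_{χ₁} ⊗ HW_{χ₂} ⊗ HW_{χ₃}` and
`M(w₁, w₂, w₃) ≠ 0` then `content(wᵢ) = χᵢ` (weight vectors of the word model are supported on
words of the right content, `apply_eq_zero_of_mem_highestWeightSpace`; characteristic zero).
This is IMW Lemma 2.2 ("each `ψ_P` is a weight vector … whose weight is determined by the
marginals") in the word model. [cite: IkenmeyerMulmuleyWalter2017, Lemma 2.2] -/
theorem wordContent_eq_of_mem_tripleHw_of_ne_zero [CharZero k] {χ₁ χ₂ χ₃ : Weight (Fin N)}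
    {M : Word3 N n → k} (hM : M ∈ tripleHw k N n χ₁ χ₂ χ₃) {t : Word3 N n} (ht : M t ≠ 0)
    (i : Fin N) :
    (wordContent t.1.1 i : ℤ) = χ₁ i ∧ (wordContent t.1.2 i : ℤ) = χ₂ i ∧
      (wordContent t.2 i : ℤ) = χ₃ i := by
  rw [mem_tripleHw_iff] at hM
  obtain ⟨h1, h2, h3⟩ := hM
  refine ⟨?_, ?_, ?_⟩
  · by_contra hne
    exact ht (apply_eq_zero_of_mem_highestWeightSpace k (h1 t.1.2 t.2) (w := t.1.1) hne)
  · by_contra hne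
    exact ht (apply_eq_zero_of_mem_highestWeightSpace k (h2 t.1.1 t.2) (w := t.1.2) hne)
  · by_contra hne
    exact ht (apply_eq_zero_of_mem_highestWeightSpace k (h3 t.1.1 t.1.2) (w := t.2) hne)

/-- **Support of anti-invariant triple tensors, injectivity**: if `M(τ · t) = sgn(τ) M(t)` for all
`τ` and `M(t) ≠ 0` then the positions of `t = (w₁, w₂, w₃)` carry pairwise distinct letter
triples (a transposition of two positions with the same letters fixes `t` and has sign `-1`, so
`M(t) = -M(t)`; characteristic `≠ 2`). Thus `t` is a labelled point SET, as for the basis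
`ψ_P` of `∧ⁿ(ℂ^r)^{⊗3}`. [cite: IkenmeyerMulmuleyWalter2017, §2 (the vectors ψ_P)] -/
theorem zip3_injective_of_antiInvariant_of_ne_zero [CharZero k] {M : Word3 N n → k}
    (hanti : ∀ τ t, M (permute3 τ t) = ((Equiv.Perm.sign τ : ℤ) : k) * M t) {t : Word3 N n}
    (ht : M t ≠ 0) : Function.Injective (zip3 t) := by
  intro p q hpq
  by_contra hne
  apply ht
  have hfix : permute3 (Equiv.swap p q) t = t := by
    have h1 : t.1.1 p = t.1.1 q := by
      have := congrArg (fun x => x.1.1) hpq; exact this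
    have h2 : t.1.2 p = t.1.2 q := by
      have := congrArg (fun x => x.1.2) hpq; exact this
    have h3 : t.2 p = t.2 q := by
      have := congrArg (fun x => x.2) hpq; exact this
    have key : ∀ (w : Word N n), w p = w q → w ∘ ⇑(Equiv.swap p q) = w := by
      intro w hw
      funext r
      simp only [Function.comp_apply]
      rcases eq_or_ne r p with rfl | hrp
      · rw [Equiv.swap_apply_left, hw]
      · rcases eq_or_ne r q with rfl | hrq
        · rw [Equiv.swap_apply_right, hw]
        · rw [Equiv.swap_apply_of_ne_of_ne hrp hrq]
    unfold permute3
    rw [key _ h1, key _ h2, key _ h3]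
  have := hanti (Equiv.swap p q) t
  rw [hfix, Equiv.Perm.sign_swap hne, Units.val_neg, Units.val_one, Int.cast_neg, Int.cast_one,
    neg_one_mul] at this
  -- this : M t = - M t
  have h2 : (2 : k) * M t = 0 := by rw [two_mul]; nth_rewrite 2 [this]; rw [add_neg_cancel]
  rcases mul_eq_zero.1 h2 with h | h
  · exact absurd h two_ne_zero
  · exact h

end AntiInvariants

/-! ### Point sets in `ℕ³` and their marginals -/

section PointSets

-- Marginals `xMarginal`, `yMarginal`, `zMarginal`, the simplex `simplex R`, pyramids `IsPyramid`
-- and the exchange lemma are the tree's `Literature.Combinatorics.Enumerative.Tomography.*`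
-- (`DiscreteTomography.lean`).

variable {N n : ℕ}

/-- The labelled point configuration of a triple of words `t = (w₁, w₂, w₃)`: the image of
`p ↦ (w₁ p, w₂ p, w₃ p)` in `ℕ³` (the point set `P` with `ψ_P = e_t`, IMW §2). [folklore] -/
def pointSetOfWord3 (t : Word3 N n) : Finset (ℕ × ℕ × ℕ) :=
  Finset.univ.image fun p : Fin n => ((t.1.1 p : ℕ), (t.1.2 p : ℕ), (t.2 p : ℕ))

/-- The map `p ↦ (w₁ p, w₂ p, w₃ p) ∈ ℕ³` is injective when `zip3 t` is. [folklore] -/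
theorem injective_coord3_of_zip3_injective {t : Word3 N n} (ht : Function.Injective (zip3 t)) :
    Function.Injective fun p : Fin n => ((t.1.1 p : ℕ), (t.1.2 p : ℕ), (t.2 p : ℕ)) := by
  intro p q hpq
  apply ht
  simp only [Prod.mk.injEq] at hpq
  obtain ⟨h1, h2, h3⟩ := hpq
  change ((t.1.1 p, t.1.2 p), t.2 p) = ((t.1.1 q, t.1.2 q), t.2 q)
  rw [Fin.ext h1, Fin.ext h2, Fin.ext h3]

/-- For an injective configuration the point set has `n` points. [folklore] -/
theorem card_pointSetOfWord3 {t : Word3 N n} (ht : Function.Injective (zip3 t)) :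
    (pointSetOfWord3 t).card = n := by
  rw [pointSetOfWord3, Finset.card_image_of_injective _ (injective_coord3_of_zip3_injective ht),
    Finset.card_univ, Fintype.card_fin]

/-- Counting points of an injective configuration by a coordinate predicate. [folklore] -/
theorem card_filter_pointSetOfWord3 {t : Word3 N n} (ht : Function.Injective (zip3 t))
    (q : ℕ × ℕ × ℕ → Prop) [DecidablePred q] :
    ((pointSetOfWord3 t).filter q).card =
      (Finset.univ.filter fun p : Fin n => q ((t.1.1 p : ℕ), (t.1.2 p : ℕ), (t.2 p : ℕ))).card := by
  rw [pointSetOfWord3, Finset.filter_image,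
    Finset.card_image_of_injOn ((injective_coord3_of_zip3_injective ht).injOn)]

/-- The number of positions of a word carrying a letter with value `i`: the content at `i` if
`i < N`, and `0` otherwise. [folklore] -/
theorem card_filter_val_eq (w : Word N n) (i : ℕ) :
    (Finset.univ.filter fun p : Fin n => (w p : ℕ) = i).card =
      if h : i < N then wordContent w ⟨i, h⟩ else 0 := by
  split_ifs with h
  · rw [wordContent]
    congr 1
    ext p
    simp only [Finset.mem_filter, Finset.mem_univ, true_and]
    constructor
    · intro hp; exact Fin.ext hp
    · intro hp; rw [hp]
  · rw [Finset.card_eq_zero, Finset.filter_eq_empty_iff]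
    intro p _ hp
    exact h (hp ▸ (w p).2)

/-- The zero-padded rows of a partition with at most `N` parts, read through its `GL_N`-weight.
[folklore] -/
theorem getD_sortedParts_eq_dite (lam : Nat.Partition n) (hl : lam.parts.card ≤ N) (i : ℕ) :
    (lam.sortedParts.getD i 0 : ℤ) =
      if h : i < N then Weight.ofPartition N lam ⟨i, h⟩ else 0 := by
  split_ifs with h
  · rw [Weight.ofPartition_apply]
  · rw [Literature.Computability.Complexity.getD_sortedParts_eq_zero lam (hl.trans (not_lt.1 h))]
    rfl

/-- **Marginals of the support of an anti-invariant triple tensor.** If `M ∈ HW_λ ⊗ HW_μ ⊗ HW_ν`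
is anti-invariant and `M(t) ≠ 0`, then the point set of `t` has `n` points and marginals
`(λ, μ, ν)` (rows): weight vectors are supported on words of the right content, and
anti-invariance forces the configuration to be injective (IMW §2: "each `ψ_P` is a weight vector
… whose weight is determined by the marginals"). [cite: IkenmeyerMulmuleyWalter2017, Lemma 2.2] -/
theorem marginals_pointSetOfWord3 {k : Type*} [Field k] [CharZero k] {lam mu nu : Nat.Partition n}
    (hl : lam.parts.card ≤ N) (hm : mu.parts.card ≤ N) (hn : nu.parts.card ≤ N)
    {M : Word3 N n → k} (hM : M ∈ tripleHw k N n (Weight.ofPartition N lam)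
      (Weight.ofPartition N mu) (Weight.ofPartition N nu))
    (hanti : ∀ τ t, M (permute3 τ t) = ((Equiv.Perm.sign τ : ℤ) : k) * M t) {t : Word3 N n}
    (ht : M t ≠ 0) :
    (∀ i, xMarginal (pointSetOfWord3 t) i = lam.sortedParts.getD i 0) ∧
      (∀ j, yMarginal (pointSetOfWord3 t) j = mu.sortedParts.getD j 0) ∧
      (∀ l, zMarginal (pointSetOfWord3 t) l = nu.sortedParts.getD l 0) := by
  have hinj := zip3_injective_of_antiInvariant_of_ne_zero k hanti ht
  have hc := fun i => wordContent_eq_of_mem_tripleHw_of_ne_zero k hM ht i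
  refine ⟨fun i => ?_, fun j => ?_, fun l => ?_⟩
  · have e : (xMarginal (pointSetOfWord3 t) i : ℤ) = (lam.sortedParts.getD i 0 : ℤ) := by
      rw [xMarginal, card_filter_pointSetOfWord3 hinj, getD_sortedParts_eq_dite lam hl]
      simp only
      rw [card_filter_val_eq]
      split_ifs with h
      · exact (hc ⟨i, h⟩).1
      · rfl
    exact_mod_cast e
  · have e : (yMarginal (pointSetOfWord3 t) j : ℤ) = (mu.sortedParts.getD j 0 : ℤ) := by
      rw [yMarginal, card_filter_pointSetOfWord3 hinj, getD_sortedParts_eq_dite mu hm]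
      simp only
      rw [card_filter_val_eq]
      split_ifs with h
      · exact (hc ⟨j, h⟩).2.1
      · rfl
    exact_mod_cast e
  · have e : (zMarginal (pointSetOfWord3 t) l : ℤ) = (nu.sortedParts.getD l 0 : ℤ) := by
      rw [zMarginal, card_filter_pointSetOfWord3 hinj, getD_sortedParts_eq_dite nu hn]
      simp only
      rw [card_filter_val_eq]
      split_ifs with h
      · exact (hc ⟨l, h⟩).2.2
      · rfl
    exact_mod_cast e

/-- **Upper bound, positivity form (rows).** If `g(λ, μ, νᵀ) > 0` then there is an `n`-point set
in `ℕ³` with marginals `(λ, μ, ν)` — the positivity content of `k ≤ t` (IMW Lemma 2.3, upper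
bound), via anti-invariant triple tensors in `HW_λ ⊗ HW_μ ⊗ HW_ν`.
[cite: IkenmeyerMulmuleyWalter2017, Lemma 2.3 (upper bound)] -/
theorem exists_pointSet_rows_of_kroneckerCoeff_pos (k : Type*) [Field k] [CharZero k]
    {lam mu nu : Nat.Partition n} (h : 0 < kroneckerCoeff k lam mu nu.transpose) :
    ∃ P : Finset (ℕ × ℕ × ℕ), P.card = n ∧ (∀ i, xMarginal P i = lam.sortedParts.getD i 0) ∧
      (∀ j, yMarginal P j = mu.sortedParts.getD j 0) ∧
      (∀ l, zMarginal P l = nu.sortedParts.getD l 0) := by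
  have hl : lam.parts.card ≤ n := lam.card_parts_le_size
  have hm : mu.parts.card ≤ n := mu.card_parts_le_size
  have hn : nu.parts.card ≤ n := nu.card_parts_le_size
  obtain ⟨M, hM, hM0, hanti⟩ := exists_antiInvariant_of_kroneckerCoeff_pos k hl hm hn h
  obtain ⟨t, ht⟩ : ∃ t, M t ≠ 0 := by
    by_contra hall
    push Not at hall
    exact hM0 (funext hall)
  exact ⟨pointSetOfWord3 t, card_pointSetOfWord3 (zip3_injective_of_antiInvariant_of_ne_zero k hanti ht),
    marginals_pointSetOfWord3 hl hm hn hM hanti ht⟩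

end PointSets

/-! ### Column lengths, Young diagrams and partitions -/

section Columns

variable {n : ℕ}

/-- The zero-padded parts of the transpose partition are the column lengths of the Young
diagram: `λᵀ_i` = number of boxes in column `i` of `λ` (IMW §2). [folklore] -/
theorem getD_sortedParts_transpose (μ : Nat.Partition n) (i : ℕ) :
    μ.transpose.sortedParts.getD i 0 = μ.youngDiagram.colLen i := by
  rw [← rowLen_youngDiagram, Nat.Partition.youngDiagram_transpose, YoungDiagram.rowLen_transpose]

/-- A zero-padded part of a partition of `n` is at most `n`. [folklore] -/
theorem getD_sortedParts_le (μ : Nat.Partition n) (i : ℕ) : μ.sortedParts.getD i 0 ≤ n := by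
  by_cases hi : i < μ.sortedParts.length
  · rw [List.getD_eq_getElem _ _ hi]
    have hmem : μ.sortedParts[i] ∈ μ.parts :=
      (Multiset.mem_sort _).mp (List.getElem_mem hi)
    calc μ.sortedParts[i] ≤ μ.parts.sum := Multiset.le_sum_of_mem hmem
      _ = n := μ.parts_sum
  · rw [List.getD_eq_default _ _ (not_lt.1 hi)]
    exact Nat.zero_le _

/-- A column index of a box of `λ ⊢ n` is `< n`. [folklore] -/
theorem lt_of_colLen_pos (μ : Nat.Partition n) {i : ℕ} (h : 0 < μ.youngDiagram.colLen i) : i < n := by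
  have hmem : (0, i) ∈ μ.youngDiagram := YoungDiagram.mem_iff_lt_colLen.2 h
  have h2 := YoungDiagram.mem_iff_lt_rowLen.1 hmem
  rw [rowLen_youngDiagram] at h2
  exact lt_of_lt_of_le h2 (getD_sortedParts_le μ 0)

/-- The partition of row lengths of a Young diagram `Y` (a partition of `|Y|`). Declared in
Mathlib's `YoungDiagram` namespace for dot notation (H21 convention: deliberate extension).
[folklore] -/
def _root_.YoungDiagram.rowPartition (Y : YoungDiagram) : Nat.Partition Y.cells.card where
  parts := (Y.rowLens : Multiset ℕ)
  parts_pos h := Y.pos_of_mem_rowLens _ (Multiset.mem_coe.mp h)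
  parts_sum := by rw [Multiset.sum_coe, YoungDiagram.sum_rowLens]

/-- The sorted parts of `Y.rowPartition` are the row lengths of `Y`. [folklore] -/
theorem _root_.YoungDiagram.sortedParts_rowPartition (Y : YoungDiagram) :
    Y.rowPartition.sortedParts = Y.rowLens := by
  change Multiset.sort (Y.rowLens : Multiset ℕ) (· ≥ ·) = _
  rw [Multiset.coe_sort]
  exact List.mergeSort_eq_self _ (YoungDiagram.rowLens_sorted _).pairwise

/-- The Young diagram of `Y.rowPartition` is `Y`. [folklore] -/
theorem _root_.YoungDiagram.youngDiagram_rowPartition (Y : YoungDiagram) :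
    Y.rowPartition.youngDiagram = Y := by
  have key : ∀ (l₁ l₂ : List ℕ) (h₁ : l₁.SortedGE) (h₂ : l₂.SortedGE), l₁ = l₂ →
      YoungDiagram.ofRowLens l₁ h₁ = YoungDiagram.ofRowLens l₂ h₂ := by
    rintro l₁ l₂ h₁ h₂ rfl; rfl
  exact (key _ _ _ (YoungDiagram.rowLens_sorted _) Y.sortedParts_rowPartition).trans
    YoungDiagram.ofRowLens_to_rowLens_eq_self

/-- The rows of `Y.rowPartition` are the row lengths of `Y`. [folklore] -/
theorem _root_.YoungDiagram.getD_sortedParts_rowPartition (Y : YoungDiagram) (i : ℕ) :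
    Y.rowPartition.sortedParts.getD i 0 = Y.rowLen i := by
  rw [← rowLen_youngDiagram, Y.youngDiagram_rowPartition]

/-- The rows of `(Y.rowPartition)ᵀ` are the column lengths of `Y`. [folklore] -/
theorem _root_.YoungDiagram.getD_sortedParts_rowPartition_transpose (Y : YoungDiagram) (i : ℕ) :
    Y.rowPartition.transpose.sortedParts.getD i 0 = Y.colLen i := by
  rw [getD_sortedParts_transpose, Y.youngDiagram_rowPartition]

/-- Column lengths counted through row lengths: `colLen_i(Y) = #{j < L : i < rowLen_j(Y)}` for
any `L ≥ colLen_i(Y)`. [folklore] -/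
theorem _root_.YoungDiagram.colLen_eq_card_filter (Y : YoungDiagram) (i : ℕ) {L : ℕ}
    (hL : Y.colLen i ≤ L) :
    Y.colLen i = ((Finset.range L).filter fun j => i < Y.rowLen j).card := by
  rw [YoungDiagram.colLen_eq_card]
  refine Finset.card_bij (fun c _ => c.1) ?_ ?_ ?_
  · intro c hc
    rw [YoungDiagram.mem_col_iff] at hc
    obtain ⟨hc1, hc2⟩ := hc
    have hc' : (c.1, i) ∈ Y := by rw [← hc2]; exact hc1
    rw [Finset.mem_filter, Finset.mem_range]
    exact ⟨lt_of_lt_of_le (YoungDiagram.mem_iff_lt_colLen.1 hc') hL,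
      YoungDiagram.mem_iff_lt_rowLen.1 hc'⟩
  · intro c hc c' hc' h
    rw [YoungDiagram.mem_col_iff] at hc hc'
    exact Prod.ext h (hc.2.trans hc'.2.symm)
  · intro j hj
    rw [Finset.mem_filter] at hj
    refine ⟨(j, i), ?_, rfl⟩
    rw [YoungDiagram.mem_col_iff]
    exact ⟨YoungDiagram.mem_iff_lt_rowLen.2 hj.2, rfl⟩

/-- Two partitions (possibly of differently written sizes) with the same zero-padded rows have
the same parts. [folklore] -/
theorem parts_eq_of_getD_sortedParts_eq {n n' : ℕ} {μ : Nat.Partition n} {ν : Nat.Partition n'}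
    (h : ∀ i, μ.sortedParts.getD i 0 = ν.sortedParts.getD i 0) : μ.parts = ν.parts := by
  apply Nat.Partition.parts_eq_of_youngDiagram_eq
  ext ⟨i, j⟩
  rw [YoungDiagram.mem_cells, YoungDiagram.mem_cells, YoungDiagram.mem_iff_lt_rowLen,
    YoungDiagram.mem_iff_lt_rowLen, rowLen_youngDiagram, rowLen_youngDiagram, h]

/-- The rows of the column partition `(1^m) = (m)ᵀ`: `1` in the first `m` rows, `0` beyond.
[folklore] -/
theorem getD_sortedParts_indiscrete_transpose (m i : ℕ) :
    (Nat.Partition.indiscrete m).transpose.sortedParts.getD i 0 = if i < m then 1 else 0 := by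
  rw [getD_sortedParts_transpose]
  rcases Nat.eq_zero_or_pos m with rfl | hm
  · -- the empty partition
    have h0 : ¬ 0 < (Nat.Partition.indiscrete 0).youngDiagram.colLen i := by
      intro h
      exact absurd (lt_of_colLen_pos _ h) (Nat.not_lt_zero _)
    simp only [Nat.not_lt_zero, if_false]
    omega
  · have hmem : ∀ a j : ℕ, (a, j) ∈ (Nat.Partition.indiscrete m).youngDiagram ↔ a = 0 ∧ j < m := by
      intro a j
      rw [Nat.Partition.mem_youngDiagram_iff, sortedParts_indiscrete hm.ne']
      simp only [List.length_singleton, Nat.lt_one_iff]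
      constructor
      · rintro ⟨rfl, h⟩; exact ⟨rfl, by simpa using h⟩
      · rintro ⟨rfl, h⟩; exact ⟨rfl, by simpa using h⟩
    split_ifs with hi
    · have h1 : 0 < (Nat.Partition.indiscrete m).youngDiagram.colLen i :=
        YoungDiagram.mem_iff_lt_colLen.1 ((hmem 0 i).2 ⟨rfl, hi⟩)
      have h2 : ¬ 1 < (Nat.Partition.indiscrete m).youngDiagram.colLen i := by
        intro h
        have := (hmem 1 i).1 (YoungDiagram.mem_iff_lt_colLen.2 h)
        exact absurd this.1 one_ne_zero
      omega
    · have h1 : ¬ 0 < (Nat.Partition.indiscrete m).youngDiagram.colLen i := by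
        intro h
        have := (hmem 0 i).1 (YoungDiagram.mem_iff_lt_colLen.2 h)
        exact hi this.2
      omega

end Columns

/-! ### Pyramids: the lower bound in positivity form -/

section Pyramid

/-- Pyramids are down-sets: the pointwise form of `Tomography.IsPyramid` as a lemma.
[cite: IkenmeyerMulmuleyWalter2017, §2 (pyramid)] -/
theorem _root_.Literature.Combinatorics.Enumerative.Tomography.IsPyramid.mem_of_le
    {P : Finset (ℕ × ℕ × ℕ)} (hP : IsPyramid P) {p : ℕ × ℕ × ℕ} (hp : p ∈ P) (q : ℕ × ℕ × ℕ)
    (h1 : q.1 ≤ p.1) (h2 : q.2.1 ≤ p.2.1) (h3 : q.2.2 ≤ p.2.2) : q ∈ P :=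
  (isPyramid_iff P).1 hP hp h1 h2 h3

/-- The bottom `x`-slice `{(y, z) : (0, y, z) ∈ P}` of a point set. [folklore] -/
def slice0 (P : Finset (ℕ × ℕ × ℕ)) : Finset (ℕ × ℕ) :=
  (P.filter fun p => p.1 = 0).image Prod.snd

/-- The point set above the bottom slice, shifted down by one: `{(x-1, y, z) : (x, y, z) ∈ P, x ≥ 1}`.
[folklore] -/
def shiftDown (P : Finset (ℕ × ℕ × ℕ)) : Finset (ℕ × ℕ × ℕ) :=
  (P.filter fun p => p.1 ≠ 0).image fun p => (p.1 - 1, p.2)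

variable {P : Finset (ℕ × ℕ × ℕ)}

/-- Membership in the bottom slice. [folklore] -/
theorem mem_slice0_iff {c : ℕ × ℕ} : c ∈ slice0 P ↔ ((0 : ℕ), c) ∈ P := by
  rw [slice0, Finset.mem_image]
  constructor
  · rintro ⟨p, hp, rfl⟩
    rw [Finset.mem_filter] at hp
    obtain ⟨hp, h0⟩ := hp
    have : p = (0, p.2) := Prod.ext h0 rfl
    rwa [this] at hp
  · intro h
    exact ⟨(0, c), Finset.mem_filter.2 ⟨h, rfl⟩, rfl⟩

/-- Membership in the shifted rest. [folklore] -/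
theorem mem_shiftDown_iff {q : ℕ × ℕ × ℕ} : q ∈ shiftDown P ↔ (q.1 + 1, q.2) ∈ P := by
  rw [shiftDown, Finset.mem_image]
  constructor
  · rintro ⟨p, hp, rfl⟩
    rw [Finset.mem_filter] at hp
    obtain ⟨hp, h0⟩ := hp
    have : p = (p.1 - 1 + 1, p.2) := Prod.ext (by simp only; omega) rfl
    rwa [this] at hp
  · intro h
    refine ⟨(q.1 + 1, q.2), Finset.mem_filter.2 ⟨h, Nat.succ_ne_zero _⟩, ?_⟩
    simp

/-- The bottom slice has `x_P(0)` points. [folklore] -/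
theorem card_slice0 (P : Finset (ℕ × ℕ × ℕ)) : (slice0 P).card = xMarginal P 0 := by
  rw [slice0, xMarginal, Finset.card_image_of_injOn]
  intro p hp p' hp' h
  rw [Finset.coe_filter, Set.mem_setOf_eq] at hp hp'
  exact Prod.ext (hp.2.trans hp'.2.symm) h

/-- `|P₀| + |P'| = |P|`. [folklore] -/
theorem card_shiftDown_add (P : Finset (ℕ × ℕ × ℕ)) :
    (slice0 P).card + (shiftDown P).card = P.card := by
  rw [card_slice0, xMarginal, shiftDown, Finset.card_image_of_injOn,
    Finset.card_filter_add_card_filter_not]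
  intro p hp p' hp' h
  rw [Finset.coe_filter, Set.mem_setOf_eq] at hp hp'
  simp only [Prod.mk.injEq] at h
  exact Prod.ext (by omega) h.2

/-- The shifted rest of a pyramid is a pyramid. [folklore] -/
theorem _root_.Literature.Combinatorics.Enumerative.Tomography.IsPyramid.isPyramid_shiftDown (hP : IsPyramid P) : IsPyramid (shiftDown P) := by
  rw [isPyramid_iff]
  intro p hp q h1 h2 h3
  rw [mem_shiftDown_iff] at hp ⊢
  exact hP.mem_of_le hp _ (by simp only; omega) h2 h3

/-- The bottom slice of a pyramid is a down-set of `ℕ²`. [folklore] -/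
theorem _root_.Literature.Combinatorics.Enumerative.Tomography.IsPyramid.isLowerSet_slice0 (hP : IsPyramid P) : IsLowerSet (slice0 P : Set (ℕ × ℕ)) := by
  intro c c' hle hc
  rw [Finset.mem_coe, mem_slice0_iff] at hc ⊢
  exact hP.mem_of_le hc _ le_rfl hle.1 hle.2

/-- The bottom slice of a pyramid, as a Young diagram. [folklore] -/
def _root_.Literature.Combinatorics.Enumerative.Tomography.IsPyramid.sliceDiagram (hP : IsPyramid P) : YoungDiagram :=
  ⟨slice0 P, hP.isLowerSet_slice0⟩

/-- Membership in the slice diagram. [folklore] -/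
theorem _root_.Literature.Combinatorics.Enumerative.Tomography.IsPyramid.mem_sliceDiagram (hP : IsPyramid P) {c : ℕ × ℕ} :
    c ∈ hP.sliceDiagram ↔ ((0 : ℕ), c) ∈ P :=
  mem_slice0_iff

/-- A nonempty pyramid contains the origin. [folklore] -/
theorem _root_.Literature.Combinatorics.Enumerative.Tomography.IsPyramid.zero_mem (hP : IsPyramid P) {p : ℕ × ℕ × ℕ} (hp : p ∈ P) : ((0 : ℕ), (0 : ℕ), (0 : ℕ)) ∈ P :=
  hP.mem_of_le hp _ (Nat.zero_le _) (Nat.zero_le _) (Nat.zero_le _)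

/-- In a pyramid every coordinate of a point is less than the number of points. [folklore] -/
theorem _root_.Literature.Combinatorics.Enumerative.Tomography.IsPyramid.coord_lt_card (hP : IsPyramid P) {p : ℕ × ℕ × ℕ} (hp : p ∈ P) :
    p.1 < P.card ∧ p.2.1 < P.card ∧ p.2.2 < P.card := by
  refine ⟨?_, ?_, ?_⟩
  · calc p.1 < p.1 + 1 := Nat.lt_succ_self _
      _ = ((Finset.range (p.1 + 1)).image fun i => (i, p.2)).card := by
          rw [Finset.card_image_of_injective _ fun i j h => (Prod.mk.inj h).1, Finset.card_range]
      _ ≤ P.card := Finset.card_le_card fun q hq => by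
          obtain ⟨i, hi, rfl⟩ := Finset.mem_image.1 hq
          exact hP.mem_of_le hp _ (Nat.lt_succ_iff.1 (Finset.mem_range.1 hi)) le_rfl le_rfl
  · calc p.2.1 < p.2.1 + 1 := Nat.lt_succ_self _
      _ = ((Finset.range (p.2.1 + 1)).image fun j => (p.1, j, p.2.2)).card := by
          rw [Finset.card_image_of_injective _ fun i j h => by simpa using h, Finset.card_range]
      _ ≤ P.card := Finset.card_le_card fun q hq => by
          obtain ⟨j, hj, rfl⟩ := Finset.mem_image.1 hq
          exact hP.mem_of_le hp _ le_rfl (Nat.lt_succ_iff.1 (Finset.mem_range.1 hj)) le_rfl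
  · calc p.2.2 < p.2.2 + 1 := Nat.lt_succ_self _
      _ = ((Finset.range (p.2.2 + 1)).image fun l => (p.1, p.2.1, l)).card := by
          rw [Finset.card_image_of_injective _ fun i j h => by simpa using h, Finset.card_range]
      _ ≤ P.card := Finset.card_le_card fun q hq => by
          obtain ⟨l, hl, rfl⟩ := Finset.mem_image.1 hq
          exact hP.mem_of_le hp _ le_rfl le_rfl (Nat.lt_succ_iff.1 (Finset.mem_range.1 hl))


/-! #### Marginals of the slice and of the shifted point set -/

/-- `x_{P'}(i) = x_P(i+1)`. [folklore] -/
theorem xMarginal_shiftDown (P : Finset (ℕ × ℕ × ℕ)) (i : ℕ) :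
    xMarginal (shiftDown P) i = xMarginal P (i + 1) := by
  rw [xMarginal, xMarginal]
  refine Finset.card_bij (fun q _ => (q.1 + 1, q.2)) ?_ ?_ ?_
  · intro q hq
    rw [Finset.mem_filter] at hq ⊢
    exact ⟨mem_shiftDown_iff.1 hq.1, by rw [hq.2]⟩
  · intro q _ q' _ h
    simp only [Prod.mk.injEq, Nat.add_right_cancel_iff] at h
    exact Prod.ext h.1 h.2
  · intro p hp
    rw [Finset.mem_filter] at hp
    refine ⟨(i, p.2), ?_, ?_⟩
    · rw [Finset.mem_filter, mem_shiftDown_iff]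
      exact ⟨by rw [← hp.2]; exact hp.1, rfl⟩
    · exact Prod.ext hp.2.symm rfl

/-- `y_{P'}(j)` counts the points of `P` off the bottom slice with `y = j`. [folklore] -/
theorem yMarginal_shiftDown (P : Finset (ℕ × ℕ × ℕ)) (j : ℕ) :
    yMarginal (shiftDown P) j = (P.filter fun p => p.2.1 = j ∧ ¬ p.1 = 0).card := by
  rw [yMarginal]
  refine Finset.card_bij (fun q _ => (q.1 + 1, q.2)) ?_ ?_ ?_
  · intro q hq
    rw [Finset.mem_filter] at hq ⊢
    exact ⟨mem_shiftDown_iff.1 hq.1, hq.2, Nat.succ_ne_zero _⟩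
  · intro q _ q' _ h
    simp only [Prod.mk.injEq, Nat.add_right_cancel_iff] at h
    exact Prod.ext h.1 h.2
  · intro p hp
    rw [Finset.mem_filter] at hp
    refine ⟨(p.1 - 1, p.2), ?_, ?_⟩
    · rw [Finset.mem_filter, mem_shiftDown_iff]
      refine ⟨?_, hp.2.1⟩
      have : (p.1 - 1 + 1, p.2) = p := Prod.ext (by simp only; omega) rfl
      rw [this]; exact hp.1
    · exact Prod.ext (by simp only; omega) rfl

/-- `z_{P'}(l)` counts the points of `P` off the bottom slice with `z = l`. [folklore] -/
theorem zMarginal_shiftDown (P : Finset (ℕ × ℕ × ℕ)) (l : ℕ) :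
    zMarginal (shiftDown P) l = (P.filter fun p => p.2.2 = l ∧ ¬ p.1 = 0).card := by
  rw [zMarginal]
  refine Finset.card_bij (fun q _ => (q.1 + 1, q.2)) ?_ ?_ ?_
  · intro q hq
    rw [Finset.mem_filter] at hq ⊢
    exact ⟨mem_shiftDown_iff.1 hq.1, hq.2, Nat.succ_ne_zero _⟩
  · intro q _ q' _ h
    simp only [Prod.mk.injEq, Nat.add_right_cancel_iff] at h
    exact Prod.ext h.1 h.2
  · intro p hp
    rw [Finset.mem_filter] at hp
    refine ⟨(p.1 - 1, p.2), ?_, ?_⟩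
    · rw [Finset.mem_filter, mem_shiftDown_iff]
      refine ⟨?_, hp.2.1⟩
      have : (p.1 - 1 + 1, p.2) = p := Prod.ext (by simp only; omega) rfl
      rw [this]; exact hp.1
    · exact Prod.ext (by simp only; omega) rfl

/-- Row `j` of the slice diagram = points of the bottom slice with `y = j`. [folklore] -/
theorem _root_.Literature.Combinatorics.Enumerative.Tomography.IsPyramid.rowLen_sliceDiagram (hP : IsPyramid P) (j : ℕ) :
    hP.sliceDiagram.rowLen j = (P.filter fun p => p.2.1 = j ∧ p.1 = 0).card := by
  rw [YoungDiagram.rowLen_eq_card]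
  refine Finset.card_bij (fun c _ => ((0 : ℕ), c)) ?_ ?_ ?_
  · intro c hc
    rw [YoungDiagram.mem_row_iff, hP.mem_sliceDiagram] at hc
    rw [Finset.mem_filter]
    exact ⟨hc.1, hc.2, rfl⟩
  · intro c _ c' _ h
    exact (Prod.mk.inj h).2
  · intro p hp
    rw [Finset.mem_filter] at hp
    refine ⟨p.2, ?_, Prod.ext hp.2.2.symm rfl⟩
    rw [YoungDiagram.mem_row_iff, hP.mem_sliceDiagram]
    have : ((0 : ℕ), p.2) = p := Prod.ext hp.2.2.symm rfl
    rw [this]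
    exact ⟨hp.1, hp.2.1⟩

/-- Column `l` of the slice diagram = points of the bottom slice with `z = l`. [folklore] -/
theorem _root_.Literature.Combinatorics.Enumerative.Tomography.IsPyramid.colLen_sliceDiagram (hP : IsPyramid P) (l : ℕ) :
    hP.sliceDiagram.colLen l = (P.filter fun p => p.2.2 = l ∧ p.1 = 0).card := by
  rw [YoungDiagram.colLen_eq_card]
  refine Finset.card_bij (fun c _ => ((0 : ℕ), c)) ?_ ?_ ?_
  · intro c hc
    rw [YoungDiagram.mem_col_iff, hP.mem_sliceDiagram] at hc
    rw [Finset.mem_filter]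
    exact ⟨hc.1, hc.2, rfl⟩
  · intro c _ c' _ h
    exact (Prod.mk.inj h).2
  · intro p hp
    rw [Finset.mem_filter] at hp
    refine ⟨p.2, ?_, Prod.ext hp.2.2.symm rfl⟩
    rw [YoungDiagram.mem_col_iff, hP.mem_sliceDiagram]
    have : ((0 : ℕ), p.2) = p := Prod.ext hp.2.2.symm rfl
    rw [this]
    exact ⟨hp.1, hp.2.1⟩

/-- `y`-marginals split into the bottom slice and the rest. [folklore] -/
theorem _root_.Literature.Combinatorics.Enumerative.Tomography.IsPyramid.yMarginal_eq (hP : IsPyramid P) (j : ℕ) :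
    yMarginal P j = hP.sliceDiagram.rowLen j + yMarginal (shiftDown P) j := by
  rw [hP.rowLen_sliceDiagram, yMarginal_shiftDown, yMarginal, ← Finset.filter_filter,
    ← Finset.filter_filter, Finset.card_filter_add_card_filter_not]

/-- `z`-marginals split into the bottom slice and the rest. [folklore] -/
theorem _root_.Literature.Combinatorics.Enumerative.Tomography.IsPyramid.zMarginal_eq (hP : IsPyramid P) (l : ℕ) :
    zMarginal P l = hP.sliceDiagram.colLen l + zMarginal (shiftDown P) l := by
  rw [hP.colLen_sliceDiagram, zMarginal_shiftDown, zMarginal, ← Finset.filter_filter,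
    ← Finset.filter_filter, Finset.card_filter_add_card_filter_not]

/-! #### Marginals of a pyramid are weakly decreasing and supported below `|P|` -/

/-- The `x`-marginal of a pyramid is weakly decreasing. [folklore] -/
theorem _root_.Literature.Combinatorics.Enumerative.Tomography.IsPyramid.xMarginal_succ_le (hP : IsPyramid P) (i : ℕ) :
    xMarginal P (i + 1) ≤ xMarginal P i := by
  rw [xMarginal, xMarginal]
  refine Finset.card_le_card_of_injOn (fun p => (i, p.2)) ?_ ?_
  · intro p hp
    rw [Finset.coe_filter, Set.mem_setOf_eq] at hp
    rw [Finset.coe_filter, Set.mem_setOf_eq]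
    exact ⟨hP.mem_of_le hp.1 _ (by rw [hp.2]; exact Nat.le_succ i) le_rfl le_rfl, rfl⟩
  · intro p hp p' hp' h
    rw [Finset.coe_filter, Set.mem_setOf_eq] at hp hp'
    simp only [Prod.mk.injEq, true_and] at h
    exact Prod.ext (hp.2.trans hp'.2.symm) h

/-- The `y`-marginal of a pyramid is weakly decreasing. [folklore] -/
theorem _root_.Literature.Combinatorics.Enumerative.Tomography.IsPyramid.yMarginal_succ_le (hP : IsPyramid P) (j : ℕ) :
    yMarginal P (j + 1) ≤ yMarginal P j := by
  rw [yMarginal, yMarginal]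
  refine Finset.card_le_card_of_injOn (fun p => (p.1, j, p.2.2)) ?_ ?_
  · intro p hp
    rw [Finset.coe_filter, Set.mem_setOf_eq] at hp
    rw [Finset.coe_filter, Set.mem_setOf_eq]
    exact ⟨hP.mem_of_le hp.1 _ le_rfl (by rw [hp.2]; exact Nat.le_succ j) le_rfl, rfl⟩
  · intro p hp p' hp' h
    rw [Finset.coe_filter, Set.mem_setOf_eq] at hp hp'
    simp only [Prod.mk.injEq, true_and] at h
    exact Prod.ext h.1 (Prod.ext (hp.2.trans hp'.2.symm) h.2)

/-- The `z`-marginal of a pyramid is weakly decreasing. [folklore] -/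
theorem _root_.Literature.Combinatorics.Enumerative.Tomography.IsPyramid.zMarginal_succ_le (hP : IsPyramid P) (l : ℕ) :
    zMarginal P (l + 1) ≤ zMarginal P l := by
  rw [zMarginal, zMarginal]
  refine Finset.card_le_card_of_injOn (fun p => (p.1, p.2.1, l)) ?_ ?_
  · intro p hp
    rw [Finset.coe_filter, Set.mem_setOf_eq] at hp
    rw [Finset.coe_filter, Set.mem_setOf_eq]
    exact ⟨hP.mem_of_le hp.1 _ le_rfl le_rfl (by rw [hp.2]; exact Nat.le_succ l), rfl⟩
  · intro p hp p' hp' h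
    rw [Finset.coe_filter, Set.mem_setOf_eq] at hp hp'
    simp only [Prod.mk.injEq, and_true] at h
    exact Prod.ext h.1 (Prod.ext h.2 (hp.2.trans hp'.2.symm))

/-- The `x`-marginal of a pyramid vanishes from `|P|` on. [folklore] -/
theorem _root_.Literature.Combinatorics.Enumerative.Tomography.IsPyramid.xMarginal_eq_zero (hP : IsPyramid P) {i : ℕ} (hi : P.card ≤ i) :
    xMarginal P i = 0 := by
  rw [xMarginal, Finset.card_eq_zero, Finset.filter_eq_empty_iff]
  intro p hp hpi
  have := (hP.coord_lt_card hp).1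
  omega

/-- The `y`-marginal of a pyramid vanishes from `|P|` on. [folklore] -/
theorem _root_.Literature.Combinatorics.Enumerative.Tomography.IsPyramid.yMarginal_eq_zero (hP : IsPyramid P) {j : ℕ} (hj : P.card ≤ j) :
    yMarginal P j = 0 := by
  rw [yMarginal, Finset.card_eq_zero, Finset.filter_eq_empty_iff]
  intro p hp hpj
  have := (hP.coord_lt_card hp).2.1
  omega

/-- The `z`-marginal of a pyramid vanishes from `|P|` on. [folklore] -/
theorem _root_.Literature.Combinatorics.Enumerative.Tomography.IsPyramid.zMarginal_eq_zero (hP : IsPyramid P) {l : ℕ} (hl : P.card ≤ l) :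
    zMarginal P l = 0 := by
  rw [zMarginal, Finset.card_eq_zero, Finset.filter_eq_empty_iff]
  intro p hp hpl
  have := (hP.coord_lt_card hp).2.2
  omega

/-- The `x`-marginal of a pyramid sums to `|P|` over `[0, |P|)`. [folklore] -/
theorem _root_.Literature.Combinatorics.Enumerative.Tomography.IsPyramid.sum_xMarginal (hP : IsPyramid P) :
    ∑ i ∈ Finset.range P.card, xMarginal P i = P.card :=
  (card_eq_sum_xMarginal fun _ hp => (hP.coord_lt_card hp).1).symm

/-- The `y`-marginal of a pyramid sums to `|P|` over `[0, |P|)`. [folklore] -/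
theorem _root_.Literature.Combinatorics.Enumerative.Tomography.IsPyramid.sum_yMarginal (hP : IsPyramid P) :
    ∑ i ∈ Finset.range P.card, yMarginal P i = P.card :=
  (card_eq_sum_yMarginal fun _ hp => (hP.coord_lt_card hp).2.1).symm

/-- The `z`-marginal of a pyramid sums to `|P|` over `[0, |P|)`. [folklore] -/
theorem _root_.Literature.Combinatorics.Enumerative.Tomography.IsPyramid.sum_zMarginal (hP : IsPyramid P) :
    ∑ i ∈ Finset.range P.card, zMarginal P i = P.card :=
  (card_eq_sum_zMarginal fun _ hp => (hP.coord_lt_card hp).2.2).symm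

/-! #### The three partitions of a pyramid -/

open Literature.Computability.Complexity (partitionOfRows getD_sortedParts_partitionOfRows)

/-- The partition `λ` with `λᵀ = x_P` (column lengths = `x`-marginal) of a pyramid `P`.
[folklore] -/
def xPart (P : Finset (ℕ × ℕ × ℕ)) : Nat.Partition P.card :=
  (partitionOfRows (xMarginal P) P.card P.card).transpose

/-- The partition with rows the `y`-marginal of a pyramid `P`. [folklore] -/
def yPart (P : Finset (ℕ × ℕ × ℕ)) : Nat.Partition P.card :=
  partitionOfRows (yMarginal P) P.card P.card

/-- The partition with rows the `z`-marginal of a pyramid `P`. [folklore] -/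
def zPart (P : Finset (ℕ × ℕ × ℕ)) : Nat.Partition P.card :=
  partitionOfRows (zMarginal P) P.card P.card

/-- The rows of `yPart P` are the `y`-marginal. [folklore] -/
theorem _root_.Literature.Combinatorics.Enumerative.Tomography.IsPyramid.getD_yPart (hP : IsPyramid P) (j : ℕ) :
    (yPart P).sortedParts.getD j 0 = yMarginal P j := by
  rw [yPart, getD_sortedParts_partitionOfRows (antitone_nat_of_succ_le hP.yMarginal_succ_le)
    hP.sum_yMarginal]
  split_ifs with h
  · rfl
  · exact (hP.yMarginal_eq_zero (not_lt.1 h)).symm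

/-- The rows of `zPart P` are the `z`-marginal. [folklore] -/
theorem _root_.Literature.Combinatorics.Enumerative.Tomography.IsPyramid.getD_zPart (hP : IsPyramid P) (l : ℕ) :
    (zPart P).sortedParts.getD l 0 = zMarginal P l := by
  rw [zPart, getD_sortedParts_partitionOfRows (antitone_nat_of_succ_le hP.zMarginal_succ_le)
    hP.sum_zMarginal]
  split_ifs with h
  · rfl
  · exact (hP.zMarginal_eq_zero (not_lt.1 h)).symm

/-- The columns of `xPart P` (rows of its transpose) are the `x`-marginal. [folklore] -/
theorem _root_.Literature.Combinatorics.Enumerative.Tomography.IsPyramid.getD_xPart_transpose (hP : IsPyramid P) (i : ℕ) :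
    (xPart P).transpose.sortedParts.getD i 0 = xMarginal P i := by
  rw [xPart, Nat.Partition.transpose_transpose,
    getD_sortedParts_partitionOfRows (antitone_nat_of_succ_le hP.xMarginal_succ_le) hP.sum_xMarginal]
  split_ifs with h
  · rfl
  · exact (hP.xMarginal_eq_zero (not_lt.1 h)).symm

/-- The rows of `xPart P` counted through the `x`-marginal: `#{j < |P| : i < x_P(j)}`. [folklore] -/
theorem _root_.Literature.Combinatorics.Enumerative.Tomography.IsPyramid.getD_xPart (hP : IsPyramid P) (i : ℕ) :
    (xPart P).sortedParts.getD i 0 =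
      ((Finset.range P.card).filter fun j => i < xMarginal P j).card := by
  have hrow : ∀ j, (partitionOfRows (xMarginal P) P.card P.card).youngDiagram.rowLen j =
      xMarginal P j := by
    intro j
    rw [rowLen_youngDiagram, ← hP.getD_xPart_transpose j, xPart, Nat.Partition.transpose_transpose]
  rw [xPart, getD_sortedParts_transpose, YoungDiagram.colLen_eq_card_filter _ i (L := P.card)]
  · simp_rw [hrow]
  · -- `colLen i ≤ colLen 0 = number of rows ≤ |P|`
    refine le_trans ((partitionOfRows (xMarginal P) P.card P.card).youngDiagram.colLen_anti 0 i
      (Nat.zero_le i)) ?_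
    rw [← YoungDiagram.length_rowLens, Nat.Partition.rowLens_youngDiagram,
      Nat.Partition.length_sortedParts]
    exact Nat.Partition.card_parts_le_size _

/-! #### The induction step: marginals of `P` versus those of the slice and of `shiftDown P` -/

/-- A nonempty pyramid has a nonempty bottom slice. [folklore] -/
theorem _root_.Literature.Combinatorics.Enumerative.Tomography.IsPyramid.one_le_card_slice0 (hP : IsPyramid P) (hne : P.Nonempty) : 1 ≤ (slice0 P).card := by
  rw [card_slice0]
  obtain ⟨p, hp⟩ := hne
  exact Finset.card_pos.2 ⟨(0, 0, 0), Finset.mem_filter.2 ⟨hP.zero_mem hp, rfl⟩⟩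

/-- Rows of `xPart`: `λ_i(P) = [i < |P₀|] + λ_i(P')` (the column `(1^{|P₀|})` is added row-wise).
[folklore] -/
theorem _root_.Literature.Combinatorics.Enumerative.Tomography.IsPyramid.getD_xPart_eq (hP : IsPyramid P) (hne : P.Nonempty) (i : ℕ) :
    (xPart P).sortedParts.getD i 0 =
      (Nat.Partition.indiscrete (slice0 P).card).transpose.sortedParts.getD i 0 +
        (xPart (shiftDown P)).sortedParts.getD i 0 := by
  have hP' := hP.isPyramid_shiftDown
  have hm := hP.one_le_card_slice0 hne
  have hc : P.card = ((shiftDown P).card + ((slice0 P).card - 1)) + 1 := by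
    have := card_shiftDown_add P; omega
  rw [hP.getD_xPart, hP'.getD_xPart, Finset.card_filter, Finset.card_filter, hc,
    Finset.sum_range_succ', Finset.sum_range_add, getD_sortedParts_indiscrete_transpose]
  have hzero : ∑ x ∈ Finset.range ((slice0 P).card - 1),
      (if i < xMarginal P ((shiftDown P).card + x + 1) then 1 else 0) = 0 := by
    refine Finset.sum_eq_zero fun x _ => ?_
    rw [← xMarginal_shiftDown, hP'.xMarginal_eq_zero (Nat.le_add_right _ _)]
    simp
  rw [hzero, add_zero, ← card_slice0, add_comm]
  refine congrArg₂ (· + ·) rfl (Finset.sum_congr rfl fun j _ => ?_)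
  rw [xMarginal_shiftDown]

/-- Rows of `yPart`: `y_P(j) = rowLen_j(P₀) + y_{P'}(j)`. [folklore] -/
theorem _root_.Literature.Combinatorics.Enumerative.Tomography.IsPyramid.getD_yPart_eq (hP : IsPyramid P) (j : ℕ) :
    (yPart P).sortedParts.getD j 0 =
      hP.sliceDiagram.rowPartition.sortedParts.getD j 0 + (yPart (shiftDown P)).sortedParts.getD j 0 := by
  rw [hP.getD_yPart, hP.isPyramid_shiftDown.getD_yPart, YoungDiagram.getD_sortedParts_rowPartition,
    hP.yMarginal_eq]

/-- Rows of `zPart`: `z_P(l) = colLen_l(P₀) + z_{P'}(l)`. [folklore] -/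
theorem _root_.Literature.Combinatorics.Enumerative.Tomography.IsPyramid.getD_zPart_eq (hP : IsPyramid P) (l : ℕ) :
    (zPart P).sortedParts.getD l 0 =
      hP.sliceDiagram.rowPartition.transpose.sortedParts.getD l 0 +
        (zPart (shiftDown P)).sortedParts.getD l 0 := by
  rw [hP.getD_zPart, hP.isPyramid_shiftDown.getD_zPart,
    YoungDiagram.getD_sortedParts_rowPartition_transpose, hP.zMarginal_eq]

/-! #### Assembling the lower bound with the semigroup property -/

/-- The semigroup property in row form: if the rows of `(L, M, N)` are the sums of the rows of
`(λ₁, μ₁, ν₁) ⊢ a` and `(λ₂, μ₂, ν₂) ⊢ b` and both have positive Kronecker coefficient, so has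
`(L, M, N)` (`kroneckerCoeff_pos_of_ofPartition_add`). [cite: IkenmeyerPanova2017, §1.1 (the semigroup property)] -/
theorem kroneckerCoeff_pos_of_getD_add (k : Type*) [Field k] [CharZero k] {a b c : ℕ}
    (hc : c = a + b) {l₁ m₁ n₁ : Nat.Partition a} {l₂ m₂ n₂ : Nat.Partition b}
    {L M Nn : Nat.Partition c}
    (eL : ∀ i, L.sortedParts.getD i 0 = l₁.sortedParts.getD i 0 + l₂.sortedParts.getD i 0)
    (eM : ∀ i, M.sortedParts.getD i 0 = m₁.sortedParts.getD i 0 + m₂.sortedParts.getD i 0)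
    (eN : ∀ i, Nn.sortedParts.getD i 0 = n₁.sortedParts.getD i 0 + n₂.sortedParts.getD i 0)
    (h₁ : 0 < kroneckerCoeff k l₁ m₁ n₁) (h₂ : 0 < kroneckerCoeff k l₂ m₂ n₂) :
    0 < kroneckerCoeff k L M Nn := by
  subst hc
  have ha : ∀ ρ : Nat.Partition a, ρ.parts.card ≤ a + b := fun ρ =>
    ρ.card_parts_le_size.trans (Nat.le_add_right a b)
  have hb : ∀ ρ : Nat.Partition b, ρ.parts.card ≤ a + b := fun ρ =>
    ρ.card_parts_le_size.trans (Nat.le_add_left b a)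
  have hab : ∀ ρ : Nat.Partition (a + b), ρ.parts.card ≤ a + b := fun ρ => ρ.card_parts_le_size
  have hw : ∀ {ρ : Nat.Partition (a + b)} {ρ₁ : Nat.Partition a} {ρ₂ : Nat.Partition b},
      (∀ i, ρ.sortedParts.getD i 0 = ρ₁.sortedParts.getD i 0 + ρ₂.sortedParts.getD i 0) →
      Weight.ofPartition (a + b) ρ = Weight.ofPartition (a + b) ρ₁ + Weight.ofPartition (a + b) ρ₂ := by
    intro ρ ρ₁ ρ₂ h
    funext i
    rw [Pi.add_apply, Weight.ofPartition_apply, Weight.ofPartition_apply, Weight.ofPartition_apply, h,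
      Nat.cast_add]
  exact kroneckerCoeff_pos_of_ofPartition_add (a + b) (ha l₁) (ha m₁) (ha n₁) (hb l₂) (hb m₂)
    (hb n₂) (hab L) (hab M) (hab Nn) (hw eL) (hw eM) (hw eN) h₁ h₂

/-- `g((1^m), ρ, ρᵀ) > 0`: by the transposition property this is `g((m), ρᵀ, ρᵀ) = 1`
(`kroneckerCoeff_indiscrete_pos`). [folklore] -/
theorem kroneckerCoeff_indiscrete_transpose_pos (k : Type*) [Field k] [CharZero k] {m : ℕ}
    (ρ : Nat.Partition m) :
    0 < kroneckerCoeff k (Nat.Partition.indiscrete m).transpose ρ ρ.transpose := by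
  rw [kroneckerCoeff_transpose₁₂, Nat.Partition.transpose_transpose]
  exact kroneckerCoeff_indiscrete_pos k ρ.transpose

/-- All partitions of `0` are equal (they have no parts). [folklore] -/
theorem _root_.Nat.Partition.eq_of_size_zero (μ ν : Nat.Partition 0) : μ = ν := by
  have h : ∀ ρ : Nat.Partition 0, ρ.parts = 0 := fun ρ =>
    Multiset.eq_zero_of_forall_notMem fun x hx => lt_irrefl 0
      (lt_of_lt_of_le (ρ.parts_pos hx) ((Multiset.le_sum_of_mem hx).trans (le_of_eq ρ.parts_sum)))
  exact Nat.Partition.ext (by rw [h μ, h ν])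

/-- Kronecker coefficients of the empty partitions are positive (`= 1`). [folklore] -/
theorem kroneckerCoeff_pos_of_size_zero (k : Type*) [Field k] [CharZero k] {n : ℕ} (hn : n = 0)
    (a b d : Nat.Partition n) : 0 < kroneckerCoeff k a b d := by
  subst hn
  rw [Nat.Partition.eq_of_size_zero a (Nat.Partition.indiscrete 0), Nat.Partition.eq_of_size_zero d b]
  exact kroneckerCoeff_indiscrete_pos k b

/-- **Pyramids have positive Kronecker coefficient** (in the row bookkeeping `xPart, yPart, zPart`):
induction on the number of points, peeling off the bottom slice `P₀` (a Young diagram `D`):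
`(λ(P), y_P, z_P) = ((1^{|D|}), rows D, cols D) + (λ(P'), y_{P'}, z_{P'})` row-wise,
`g((1^{|D|}), ρ_D, ρ_Dᵀ) > 0`, and the semigroup property. This is the positivity content of
IMW Lemma 2.3 (lower bound `p ≤ k`), proved here through Christandl–Harrow–Mitchison's semigroup
property instead of highest weight vectors. [cite: IkenmeyerMulmuleyWalter2017, Lemma 2.3 (lower bound)] -/
theorem _root_.Literature.Combinatorics.Enumerative.Tomography.IsPyramid.kroneckerCoeff_xPart_pos (k : Type*) [Field k] [CharZero k] :
    ∀ (c : ℕ) (P : Finset (ℕ × ℕ × ℕ)), IsPyramid P → P.card = c →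
      0 < kroneckerCoeff k (xPart P) (yPart P) (zPart P) := by
  intro c
  induction c using Nat.strong_induction_on with
  | _ c ih =>
    intro P hP hc
    rcases P.eq_empty_or_nonempty with rfl | hne
    · exact kroneckerCoeff_pos_of_size_zero k (by simp) _ _ _
    · have hP' := hP.isPyramid_shiftDown
      have hsplit := card_shiftDown_add P
      have hlt : (shiftDown P).card < c := by
        have := hP.one_le_card_slice0 hne
        omega
      have ih' := ih _ hlt (shiftDown P) hP' rfl
      have hslice : 0 < kroneckerCoeff k (Nat.Partition.indiscrete (slice0 P).card).transpose
          hP.sliceDiagram.rowPartition hP.sliceDiagram.rowPartition.transpose :=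
        kroneckerCoeff_indiscrete_transpose_pos k _
      exact kroneckerCoeff_pos_of_getD_add k hsplit.symm (hP.getD_xPart_eq hne) hP.getD_yPart_eq
        hP.getD_zPart_eq hslice ih'

end Pyramid

/-! ### Marginals prescribed by a partition triple; the coefficients `t` and `p`; both bounds -/

section Marginals

variable {n : ℕ}

/-- `P ⊆ ℕ³` has marginals `(λᵀ, μᵀ, πᵀ)`: for every `i`, the number of points with
`x`-coordinate `i` is the number of boxes in column `i` of `λ`, and likewise for `y, μ` and
`z, π` (IMW §2: "`t^λ_{μ,π}` … the number of point sets with marginals `(λᵀ, μᵀ, πᵀ)`. Note that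
`λᵀ_i` is equal to the number of boxes in the `i`-th column of `λ`"). [cite: IkenmeyerMulmuleyWalter2017, §2 (before Lemma 2.2)] -/
def HasMarginals (P : Finset (ℕ × ℕ × ℕ)) (lam μ π : Nat.Partition n) : Prop :=
  (∀ i, xMarginal P i = lam.youngDiagram.colLen i) ∧ (∀ j, yMarginal P j = μ.youngDiagram.colLen j) ∧
    ∀ l, zMarginal P l = π.youngDiagram.colLen l

/-- A point set with marginals `(λᵀ, μᵀ, πᵀ)`, `λ, μ, π ⊢ n`, lies in the box `[0, n)³`. [folklore] -/
theorem HasMarginals.subset_box {P : Finset (ℕ × ℕ × ℕ)} {lam μ π : Nat.Partition n}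
    (h : HasMarginals P lam μ π) :
    P ⊆ Finset.range n ×ˢ (Finset.range n ×ˢ Finset.range n) := by
  intro p hp
  obtain ⟨hx, hy, hz⟩ := h
  have h1 : 0 < xMarginal P p.1 := Finset.card_pos.2 ⟨p, Finset.mem_filter.2 ⟨hp, rfl⟩⟩
  have h2 : 0 < yMarginal P p.2.1 := Finset.card_pos.2 ⟨p, Finset.mem_filter.2 ⟨hp, rfl⟩⟩
  have h3 : 0 < zMarginal P p.2.2 := Finset.card_pos.2 ⟨p, Finset.mem_filter.2 ⟨hp, rfl⟩⟩
  rw [hx] at h1; rw [hy] at h2; rw [hz] at h3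
  rw [Finset.mem_product, Finset.mem_product, Finset.mem_range, Finset.mem_range, Finset.mem_range]
  exact ⟨lt_of_colLen_pos lam h1, lt_of_colLen_pos μ h2, lt_of_colLen_pos π h3⟩

/-- A point set with marginals `(λᵀ, μᵀ, πᵀ)`, `λ ⊢ n`, has `n` points. [folklore] -/
theorem HasMarginals.card_eq {P : Finset (ℕ × ℕ × ℕ)} {lam μ π : Nat.Partition n}
    (h : HasMarginals P lam μ π) : P.card = n := by
  have hsub := h.subset_box
  rw [Finset.card_eq_sum_card_fiberwise (f := fun p : ℕ × ℕ × ℕ => p.1) (t := Finset.range n)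
    fun p hp => (Finset.mem_product.1 (hsub hp)).1]
  have h2 := Literature.Computability.Complexity.sum_range_getD_sortedParts_of_le lam.transpose
    (L := n) lam.transpose.card_parts_le_size
  refine Eq.trans (Finset.sum_congr rfl fun i _ => ?_) h2
  rw [getD_sortedParts_transpose, ← h.1 i]
  rfl

open scoped Classical in
/-- **`t^λ_{μ,π}`**: the number of point sets `P ⊆ ℕ³` with marginals `(λᵀ, μᵀ, πᵀ)` (IMW §2; such
`P` lie in `[0, n)³`, `HasMarginals.subset_box`, so this is a finite count).
[cite: IkenmeyerMulmuleyWalter2017, §2 (definition of t, before Lemma 2.2)] -/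
def pointSetCount (lam μ π : Nat.Partition n) : ℕ :=
  ((Finset.range n ×ˢ (Finset.range n ×ˢ Finset.range n)).powerset.filter
    fun P => HasMarginals P lam μ π).card

open scoped Classical in
/-- **`p^λ_{μ,π}`**: the number of pyramids with marginals `(λᵀ, μᵀ, πᵀ)` (IMW §2).
[cite: IkenmeyerMulmuleyWalter2017, §2 (definition of p, before Lemma 2.3)] -/
def pyramidCount (lam μ π : Nat.Partition n) : ℕ :=
  ((Finset.range n ×ˢ (Finset.range n ×ˢ Finset.range n)).powerset.filter
    fun P => HasMarginals P lam μ π ∧ IsPyramid P).card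

/-- `t^λ_{μ,π} > 0` iff some point set has marginals `(λᵀ, μᵀ, πᵀ)`. [folklore] -/
theorem pointSetCount_pos_iff (lam μ π : Nat.Partition n) :
    0 < pointSetCount lam μ π ↔ ∃ P : Finset (ℕ × ℕ × ℕ), HasMarginals P lam μ π := by
  classical
  rw [pointSetCount, Finset.card_pos]
  constructor
  · rintro ⟨P, hP⟩
    rw [Finset.mem_filter] at hP
    exact ⟨P, hP.2⟩
  · rintro ⟨P, hP⟩
    exact ⟨P, Finset.mem_filter.2 ⟨Finset.mem_powerset.2 hP.subset_box, hP⟩⟩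

/-- `p^λ_{μ,π} > 0` iff some pyramid has marginals `(λᵀ, μᵀ, πᵀ)`. [folklore] -/
theorem pyramidCount_pos_iff (lam μ π : Nat.Partition n) :
    0 < pyramidCount lam μ π ↔ ∃ P : Finset (ℕ × ℕ × ℕ), HasMarginals P lam μ π ∧ IsPyramid P := by
  classical
  rw [pyramidCount, Finset.card_pos]
  constructor
  · rintro ⟨P, hP⟩
    rw [Finset.mem_filter] at hP
    exact ⟨P, hP.2⟩
  · rintro ⟨P, hP⟩
    exact ⟨P, Finset.mem_filter.2 ⟨Finset.mem_powerset.2 hP.1.subset_box, hP⟩⟩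

/-- `p^λ_{μ,π} ≤ t^λ_{μ,π}` (pyramids are point sets). [cite: IkenmeyerMulmuleyWalter2017, Lemma 2.3] -/
theorem pyramidCount_le_pointSetCount (lam μ π : Nat.Partition n) :
    pyramidCount lam μ π ≤ pointSetCount lam μ π := by
  classical
  rw [pyramidCount, pointSetCount]
  refine Finset.card_le_card fun P hP => ?_
  rw [Finset.mem_filter] at hP ⊢
  exact ⟨hP.1, hP.2.1⟩

/-- **Lemma 2.3, upper bound, in positivity form: `k^λ_{μ,π} > 0 ⇒ t^λ_{μ,π} > 0`.** A positive
Kronecker coefficient `g(λ, μ, π)` (any field of characteristic zero) forces a point set with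
marginals `(λᵀ, μᵀ, πᵀ)`: `g(λ, μ, π) = g(λᵀ, μᵀ, π)` is the dimension of the anti-invariant
triple tensors in `HW_{λᵀ} ⊗ HW_{μᵀ} ⊗ HW_{πᵀ}`, which are supported on injective configurations
of the right contents. (IMW prove `k ≤ t` via Lemmas 2.1–2.2.)
[cite: IkenmeyerMulmuleyWalter2017, Lemma 2.3 (upper bound)] -/
theorem exists_hasMarginals_of_kroneckerCoeff_pos (k : Type*) [Field k] [CharZero k]
    {lam μ π : Nat.Partition n} (h : 0 < kroneckerCoeff k lam μ π) :
    ∃ P : Finset (ℕ × ℕ × ℕ), HasMarginals P lam μ π := by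
  rw [kroneckerCoeff_transpose₁₂, ← π.transpose_transpose] at h
  obtain ⟨P, -, hx, hy, hz⟩ := exists_pointSet_rows_of_kroneckerCoeff_pos k h
  refine ⟨P, fun i => ?_, fun j => ?_, fun l => ?_⟩
  · rw [hx, getD_sortedParts_transpose]
  · rw [hy, getD_sortedParts_transpose]
  · rw [hz, getD_sortedParts_transpose]

/-- `k^λ_{μ,π} > 0 ⇒ t^λ_{μ,π} > 0`. [cite: IkenmeyerMulmuleyWalter2017, Lemma 2.3 (upper bound)] -/
theorem pointSetCount_pos_of_kroneckerCoeff_pos (k : Type*) [Field k] [CharZero k]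
    {lam μ π : Nat.Partition n} (h : 0 < kroneckerCoeff k lam μ π) : 0 < pointSetCount lam μ π :=
  (pointSetCount_pos_iff lam μ π).2 (exists_hasMarginals_of_kroneckerCoeff_pos k h)

/-- **Lemma 2.3, lower bound, in positivity form: a pyramid with marginals `(λᵀ, μᵀ, πᵀ)` forces
`k^λ_{μ,π} > 0`** (any field of characteristic zero). From `IsPyramid.kroneckerCoeff_xPart_pos`:
the partitions `(xPart P, yPart P, zPart P)` are `(λ, μᵀ, πᵀ)`, and `g(λ, μᵀ, πᵀ) = g(λ, μ, π)`.
(IMW: `ψ_P` is a highest weight vector for a pyramid `P`.) [cite: IkenmeyerMulmuleyWalter2017, Lemma 2.3 (lower bound)] -/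
theorem kroneckerCoeff_pos_of_isPyramid (k : Type*) [Field k] [CharZero k] {P : Finset (ℕ × ℕ × ℕ)}
    (hP : IsPyramid P) {lam μ π : Nat.Partition n} (hM : HasMarginals P lam μ π) :
    0 < kroneckerCoeff k lam μ π := by
  have hc : P.card = n := hM.card_eq
  subst hc
  obtain ⟨hx, hy, hz⟩ := hM
  have hclaim := IsPyramid.kroneckerCoeff_xPart_pos k _ P hP rfl
  have e1 : xPart P = lam := by
    have h' : (xPart P).transpose = lam.transpose :=
      Nat.Partition.ext (parts_eq_of_getD_sortedParts_eq fun i => by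
        rw [hP.getD_xPart_transpose, hx, getD_sortedParts_transpose])
    rw [← (xPart P).transpose_transpose, h', lam.transpose_transpose]
  have e2 : yPart P = μ.transpose :=
    Nat.Partition.ext (parts_eq_of_getD_sortedParts_eq fun j => by
      rw [hP.getD_yPart, hy, getD_sortedParts_transpose])
  have e3 : zPart P = π.transpose :=
    Nat.Partition.ext (parts_eq_of_getD_sortedParts_eq fun l => by
      rw [hP.getD_zPart, hz, getD_sortedParts_transpose])
  rw [e1, e2, e3] at hclaim
  rw [kroneckerCoeff_transpose]
  exact hclaim

/-- `p^λ_{μ,π} > 0 ⇒ k^λ_{μ,π} > 0`. [cite: IkenmeyerMulmuleyWalter2017, Lemma 2.3 (lower bound)] -/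
theorem kroneckerCoeff_pos_of_pyramidCount_pos (k : Type*) [Field k] [CharZero k]
    {lam μ π : Nat.Partition n} (h : 0 < pyramidCount lam μ π) : 0 < kroneckerCoeff k lam μ π := by
  obtain ⟨P, hM, hP⟩ := (pyramidCount_pos_iff lam μ π).1 h
  exact kroneckerCoeff_pos_of_isPyramid k hP hM

/-- **Corollary 2.4 in positivity form.** If every point set with marginals `(λᵀ, μᵀ, πᵀ)` is a
pyramid, then `k^λ_{μ,π} > 0 ↔ t^λ_{μ,π} > 0` (IMW Cor. 2.4: `k = t = p`).
[cite: IkenmeyerMulmuleyWalter2017, Corollary 2.4] -/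
theorem kroneckerCoeff_pos_iff_pointSetCount_pos_of_forall_isPyramid (k : Type*) [Field k] [CharZero k]
    {lam μ π : Nat.Partition n}
    (hall : ∀ P : Finset (ℕ × ℕ × ℕ), HasMarginals P lam μ π → IsPyramid P) :
    0 < kroneckerCoeff k lam μ π ↔ 0 < pointSetCount lam μ π := by
  constructor
  · exact pointSetCount_pos_of_kroneckerCoeff_pos k
  · intro h
    obtain ⟨P, hM⟩ := (pointSetCount_pos_iff lam μ π).1 h
    exact kroneckerCoeff_pos_of_isPyramid k (hall P hM) hM

end Marginals

/-! ### Simplex-like marginals (IMW §3): every compatible point set is a pyramid -/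

section Simplex

/-- **`r(n)`**: the maximal `r` with `|P_r| ≤ n` (IMW §3: "`r` is necessarily equal to the maximal
`r` such that `|P_r| = r(r+1)(r+2)/6 ≤ n`"); `r ≤ n` since `|P_r| ≥ r`. The simplex
`P_r = {x + y + z < r}` is the tree's `Tomography.simplex r`. [cite: IkenmeyerMulmuleyWalter2017, §3 (definition of p(n))] -/
def simplexRadius (n : ℕ) : ℕ :=
  Nat.findGreatest (fun r => (simplex r).card ≤ n) n

/-- `|P_{r(n)}| ≤ n`. [folklore] -/
theorem card_simplex_simplexRadius_le (n : ℕ) : (simplex (simplexRadius n)).card ≤ n :=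
  Nat.findGreatest_spec (P := fun r => (simplex r).card ≤ n) (Nat.zero_le n)
    (by rw [simplex_zero, Finset.card_empty]; exact Nat.zero_le n)

/-- **`p(n) = b_r · (1,1,1) + r (n - |P_r|)`**, `r = r(n)`, `b_r = ∑_{p ∈ P_r} p` the barycentre of
the simplex (IMW §3): the minimal coordinate sum `∑_{p ∈ P} (x + y + z)` of an `n`-point set
(`Tomography.exchange_le`). [cite: IkenmeyerMulmuleyWalter2017, §3 (definition of p(n))] -/
def minMoment (n : ℕ) : ℕ :=
  coordSum (simplex (simplexRadius n)) + simplexRadius n * (n - (simplex (simplexRadius n)).card)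

variable {n : ℕ}

/-- The first moment `∑_i i λᵀ_i + ∑_j j μᵀ_j + ∑_k k πᵀ_k` of the marginals `(λᵀ, μᵀ, πᵀ)`
(IMW §3; all columns have index `< n`). [cite: IkenmeyerMulmuleyWalter2017, §3 (definition of simplex-like)] -/
def columnMoment (lam μ π : Nat.Partition n) : ℕ :=
  ∑ i ∈ Finset.range n,
    i * (lam.youngDiagram.colLen i + μ.youngDiagram.colLen i + π.youngDiagram.colLen i)

/-- **Simplex-like partition triples** (IMW §3): `|λ| = |μ| = |π| = n ≠ 0` and
`∑_i i λᵀ_i + ∑_j j μᵀ_j + ∑_k k πᵀ_k = p(n)`. (IMW add "the Young diagrams of `λ, μ, π` have at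
most `r + 1` columns"; only the displayed moment identity is used in the proof of Lemma 3.1, and
we omit the column condition, which makes this class larger.)
[cite: IkenmeyerMulmuleyWalter2017, §3 (definition of simplex-like)] -/
def IsSimplexLike (lam μ π : Nat.Partition n) : Prop :=
  n ≠ 0 ∧ columnMoment lam μ π = minMoment n

/-- The first moment of a point set is determined by its marginals:
`∑_{p ∈ P} (x+y+z) = ∑_i i λᵀ_i + ∑_j j μᵀ_j + ∑_k k πᵀ_k` (IMW, proof of Lemma 3.1: "the
barycenter is purely a function of the marginals"; `Tomography.coordSum_eq_sum_marginals`).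
[cite: IkenmeyerMulmuleyWalter2017, Lemma 3.1 (proof)] -/
theorem HasMarginals.coordSum_eq {P : Finset (ℕ × ℕ × ℕ)} {lam μ π : Nat.Partition n}
    (h : HasMarginals P lam μ π) : coordSum P = columnMoment lam μ π := by
  have hsub := h.subset_box
  obtain ⟨hx, hy, hz⟩ := h
  have hN : ∀ p ∈ P, p.1 < n ∧ p.2.1 < n ∧ p.2.2 < n := fun p hp => by
    have h1 := Finset.mem_product.1 (hsub hp)
    have h2 := Finset.mem_product.1 h1.2
    exact ⟨Finset.mem_range.1 h1.1, Finset.mem_range.1 h2.1, Finset.mem_range.1 h2.2⟩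
  rw [coordSum_eq_sum_marginals hN, columnMoment, ← Finset.sum_add_distrib, ← Finset.sum_add_distrib]
  refine Finset.sum_congr rfl fun i _ => ?_
  rw [hx, hy, hz]
  ring

/-- **IMW Lemma 3.1.** If `(λ, μ, π)` is simplex-like then every point set with marginals
`(λᵀ, μᵀ, πᵀ)` satisfies `P_r ⊆ P ⊆ P_{r+1}` for `r = r(n)` (the equality case of the exchange
inequality, `Tomography.exchange_eq_iff`). [cite: IkenmeyerMulmuleyWalter2017, Lemma 3.1] -/
theorem IsSimplexLike.simplex_subset {lam μ π : Nat.Partition n} (hs : IsSimplexLike lam μ π)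
    {P : Finset (ℕ × ℕ × ℕ)} (hM : HasMarginals P lam μ π) :
    simplex (simplexRadius n) ⊆ P ∧ P ⊆ simplex (simplexRadius n + 1) := by
  refine (exchange_eq_iff P (simplexRadius n)).1 ?_
  have hle := card_simplex_simplexRadius_le n
  rw [hM.coordSum_eq, hs.2, minMoment, hM.card_eq, add_assoc, ← mul_add, Nat.sub_add_cancel hle]

/-- **IMW Lemma 3.1 (conclusion).** For simplex-like `(λ, μ, π)`, every point set with marginals
`(λᵀ, μᵀ, πᵀ)` is a pyramid (`Tomography.isPyramid_of_simplex_subset`).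
[cite: IkenmeyerMulmuleyWalter2017, Lemma 3.1] -/
theorem IsSimplexLike.isPyramid {lam μ π : Nat.Partition n} (hs : IsSimplexLike lam μ π)
    {P : Finset (ℕ × ℕ × ℕ)} (hM : HasMarginals P lam μ π) : IsPyramid P := by
  obtain ⟨h₁, h₂⟩ := hs.simplex_subset hM
  exact isPyramid_of_simplex_subset h₁ h₂

/-- For simplex-like `(λ, μ, π)`: `t^λ_{μ,π} = p^λ_{μ,π}` (IMW Thm. 3.2, second equality).
[cite: IkenmeyerMulmuleyWalter2017, Theorem 3.2] -/
theorem IsSimplexLike.pointSetCount_eq_pyramidCount {lam μ π : Nat.Partition n}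
    (hs : IsSimplexLike lam μ π) : pointSetCount lam μ π = pyramidCount lam μ π := by
  classical
  rw [pointSetCount, pyramidCount]
  congr 1
  refine Finset.filter_congr fun P _ => ?_
  exact ⟨fun h => ⟨h, hs.isPyramid h⟩, fun h => h.1⟩

/-- **IMW Theorem 3.2 in positivity form.** For simplex-like `(λ, μ, π)` and any field `k` of
characteristic zero: `k^λ_{μ,π} > 0 ↔ t^λ_{μ,π} > 0` (IMW: `k = t = p`; the positivity
equivalence is what the NP-hardness reduction, Thm. 3.4, uses). [cite: IkenmeyerMulmuleyWalter2017, Theorem 3.2] -/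
theorem IsSimplexLike.kroneckerCoeff_pos_iff (k : Type*) [Field k] [CharZero k]
    {lam μ π : Nat.Partition n} (hs : IsSimplexLike lam μ π) :
    0 < kroneckerCoeff k lam μ π ↔ 0 < pointSetCount lam μ π :=
  kroneckerCoeff_pos_iff_pointSetCount_pos_of_forall_isPyramid k fun _ hM => hs.isPyramid hM

end Simplex


end Literature.NumberTheory.DiophantineGeometry
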